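import Mathlib
import HarnessLib
import Summits.AtomisticToContinuum.Crystallization.Theorems.PricedLinkCensusSoftFourRingsHexagon2

/-!
# Soft four-rings, endgame: the wings around an alternating hexagon

Support file for `SoftFourRings` (route `PricedLinkCensus`, sub-problem `Crystallization`),
endgame step (E4) of the evidence file (§12.8), point-level form.  With type-A data at `v`
(`(a, b, c, d)`), at its `α`-partner `b` (`(a, v, c, e)`), at its `γ`-partner `d`
(`(a₃, b₃, c₃, v)`, oriented so that `a ∼ a₃`, `c ∼ c₃`) and at `e` (`(a₄, b₄, c₄, b)`, oriented
so that `a ∼ a₄`, `c ∼ c₄`), and no alternating 4-cycle (`e ≠ b₃`, `d ≠ b₄`):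

* `typeO_fill` — a type-O neighbourhood with two known bonds outside its designated pair is
  determined;
* `hexagon_wings` — `a₃ ≠ a₄`, `c₃ ≠ c₄`, and the neighbourhoods of the six wings:
  `N(a) = {v, b, a₃, a₄}`, `N(c) = {v, b, c₃, c₄}`, `N(a₃) = {d, b₃, a, a₄}`,
  `N(a₄) = {e, b₄, a, a₃}`, `N(c₃) = {d, b₃, c, c₄}`, `N(c₄) = {e, b₄, c, c₃}`, together with
  the eight type exclusions between the named type-A and type-O points.
-/

namespace Summit.AtomisticToContinuum.Crystallization.Theorems

open Real RealInnerProductSpace Literature.Geometry.DiscreteGeometry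

section Pairs

variable {B : Finset (Finset (EuclideanSpace ℝ (Fin 3)))}

/-- **Filling a type-O neighbourhood**: if `N(u) = {m₁, m₂, p, q}` with `p ∼ q` and `u` is bonded
to `r₁ ≠ r₂` outside `{m₁, m₂}`, then `N(u) = {m₁, m₂, r₁, r₂}` and `r₁ ∼ r₂`. -/
theorem typeO_fill {u m₁ m₂ p q r₁ r₂ : EuclideanSpace ℝ (Fin 3)}
    (hNu : ∀ y, ({u, y} : Finset (EuclideanSpace ℝ (Fin 3))) ∈ B ↔ (y = m₁ ∨ y = m₂ ∨ y = p ∨ y = q))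
    (hpq : ({p, q} : Finset (EuclideanSpace ℝ (Fin 3))) ∈ B)
    (hr₁ : ({u, r₁} : Finset (EuclideanSpace ℝ (Fin 3))) ∈ B)
    (hr₂ : ({u, r₂} : Finset (EuclideanSpace ℝ (Fin 3))) ∈ B)
    (h₁₁ : r₁ ≠ m₁) (h₁₂ : r₁ ≠ m₂) (h₂₁ : r₂ ≠ m₁) (h₂₂ : r₂ ≠ m₂) (h₁₂' : r₁ ≠ r₂) :
    (∀ y, ({u, y} : Finset (EuclideanSpace ℝ (Fin 3))) ∈ B ↔ (y = m₁ ∨ y = m₂ ∨ y = r₁ ∨ y = r₂)) ∧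
      ({r₁, r₂} : Finset (EuclideanSpace ℝ (Fin 3))) ∈ B := by
  have e₁ : r₁ = p ∨ r₁ = q := by
    rcases (hNu r₁).1 hr₁ with h | h | h | h
    exacts [absurd h h₁₁, absurd h h₁₂, Or.inl h, Or.inr h]
  have e₂ : r₂ = p ∨ r₂ = q := by
    rcases (hNu r₂).1 hr₂ with h | h | h | h
    exacts [absurd h h₂₁, absurd h h₂₂, Or.inl h, Or.inr h]
  rcases e₁ with rfl | rfl <;> rcases e₂ with rfl | rfl
  · exact absurd rfl h₁₂'
  · exact ⟨hNu, hpq⟩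
  · refine ⟨fun y => (hNu y).trans ?_, by rw [Finset.pair_comm]; exact hpq⟩
    constructor
    · rintro (h | h | h | h)
      exacts [Or.inl h, Or.inr (Or.inl h), Or.inr (Or.inr (Or.inr h)), Or.inr (Or.inr (Or.inl h))]
    · rintro (h | h | h | h)
      exacts [Or.inl h, Or.inr (Or.inl h), Or.inr (Or.inr (Or.inr h)), Or.inr (Or.inr (Or.inl h))]
  · exact absurd rfl h₁₂'

end Pairs

section Setting

variable {X : Finset (EuclideanSpace ℝ (Fin 3))} {B : Finset (Finset (EuclideanSpace ℝ (Fin 3)))}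
  (hT : musinTarasov2012_tammes_thirteen) (hX1 : ∀ y ∈ X, ‖y‖ = 1) (hcard : X.card = 12)
  (hsepX : ∀ u ∈ X, ∀ u' ∈ X, u ≠ u' → ⟪u, u'⟫ ≤ 1 - 1 / (2 * (101 / 100 : ℝ) ^ 2))
  (hB : ∀ T ∈ B, ∃ u ∈ X, ∃ u' ∈ X, u ≠ u' ∧ 1 - (101 / 100 : ℝ) ^ 2 / 2 ≤ ⟪u, u'⟫ ∧ T = {u, u'})
  (hBcard : B.card = 24)
  (hdeg : ∀ v ∈ X, ∃ w : Fin 4 → EuclideanSpace ℝ (Fin 3), (∀ k, w k ∈ X) ∧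
    Function.Injective w ∧ (∀ k, w k ≠ v) ∧
    (∀ k, ({v, w k} : Finset (EuclideanSpace ℝ (Fin 3))) ∈ B) ∧
    ∀ y, ({v, y} : Finset (EuclideanSpace ℝ (Fin 3))) ∈ B → ∃ k, y = w k)

include hT hX1 hcard hsepX hB hBcard hdeg in
open scoped Classical in
/-- **The wings around the hexagon** (see the module docstring). -/
theorem hexagon_wings {v a b c d e a₃ b₃ c₃ a₄ b₄ c₄ : EuclideanSpace ℝ (Fin 3)}
    (hN : ∀ y, ({v, y} : Finset (EuclideanSpace ℝ (Fin 3))) ∈ B ↔ (y = a ∨ y = b ∨ y = c ∨ y = d))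
    (hd : a ≠ b ∧ a ≠ c ∧ a ≠ d ∧ b ≠ c ∧ b ≠ d ∧ c ≠ d)
    (hab : ({a, b} : Finset (EuclideanSpace ℝ (Fin 3))) ∈ B)
    (hbc : ({b, c} : Finset (EuclideanSpace ℝ (Fin 3))) ∈ B)
    (hac : ({a, c} : Finset (EuclideanSpace ℝ (Fin 3))) ∉ B)
    (had : ({a, d} : Finset (EuclideanSpace ℝ (Fin 3))) ∉ B)
    (hbd : ({b, d} : Finset (EuclideanSpace ℝ (Fin 3))) ∉ B)
    (hcd : ({c, d} : Finset (EuclideanSpace ℝ (Fin 3))) ∉ B)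
    (he : e ≠ v ∧ e ≠ a ∧ e ≠ b ∧ e ≠ c ∧ e ≠ d)
    (hNb : ∀ y, ({b, y} : Finset (EuclideanSpace ℝ (Fin 3))) ∈ B ↔ (y = a ∨ y = v ∨ y = c ∨ y = e))
    (hae : ({a, e} : Finset (EuclideanSpace ℝ (Fin 3))) ∉ B)
    (hve : ({v, e} : Finset (EuclideanSpace ℝ (Fin 3))) ∉ B)
    (hce : ({c, e} : Finset (EuclideanSpace ℝ (Fin 3))) ∉ B)
    (hN₃ : ∀ y, ({d, y} : Finset (EuclideanSpace ℝ (Fin 3))) ∈ B ↔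
      (y = a₃ ∨ y = b₃ ∨ y = c₃ ∨ y = v))
    (hd₃ : a₃ ≠ b₃ ∧ a₃ ≠ c₃ ∧ a₃ ≠ v ∧ b₃ ≠ c₃ ∧ b₃ ≠ v ∧ c₃ ≠ v)
    (hab₃ : ({a₃, b₃} : Finset (EuclideanSpace ℝ (Fin 3))) ∈ B)
    (hbc₃ : ({b₃, c₃} : Finset (EuclideanSpace ℝ (Fin 3))) ∈ B)
    (hac₃ : ({a₃, c₃} : Finset (EuclideanSpace ℝ (Fin 3))) ∉ B)
    (hav₃ : ({a₃, v} : Finset (EuclideanSpace ℝ (Fin 3))) ∉ B)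
    (hbv₃ : ({b₃, v} : Finset (EuclideanSpace ℝ (Fin 3))) ∉ B)
    (hcv₃ : ({c₃, v} : Finset (EuclideanSpace ℝ (Fin 3))) ∉ B)
    (hN₄ : ∀ y, ({e, y} : Finset (EuclideanSpace ℝ (Fin 3))) ∈ B ↔
      (y = a₄ ∨ y = b₄ ∨ y = c₄ ∨ y = b))
    (hd₄ : a₄ ≠ b₄ ∧ a₄ ≠ c₄ ∧ a₄ ≠ b ∧ b₄ ≠ c₄ ∧ b₄ ≠ b ∧ c₄ ≠ b)
    (hab₄ : ({a₄, b₄} : Finset (EuclideanSpace ℝ (Fin 3))) ∈ B)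
    (hbc₄ : ({b₄, c₄} : Finset (EuclideanSpace ℝ (Fin 3))) ∈ B)
    (hac₄ : ({a₄, c₄} : Finset (EuclideanSpace ℝ (Fin 3))) ∉ B)
    (hab₄' : ({a₄, b} : Finset (EuclideanSpace ℝ (Fin 3))) ∉ B)
    (hbb₄ : ({b₄, b} : Finset (EuclideanSpace ℝ (Fin 3))) ∉ B)
    (hcb₄ : ({c₄, b} : Finset (EuclideanSpace ℝ (Fin 3))) ∉ B)
    (haa₃ : ({a, a₃} : Finset (EuclideanSpace ℝ (Fin 3))) ∈ B)
    (hcc₃ : ({c, c₃} : Finset (EuclideanSpace ℝ (Fin 3))) ∈ B)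
    (haa₄ : ({a, a₄} : Finset (EuclideanSpace ℝ (Fin 3))) ∈ B)
    (hcc₄ : ({c, c₄} : Finset (EuclideanSpace ℝ (Fin 3))) ∈ B)
    (heb₃ : e ≠ b₃) (hdb₄ : d ≠ b₄) :
    a₃ ≠ a₄ ∧ c₃ ≠ c₄ ∧
    (∀ y, ({a, y} : Finset (EuclideanSpace ℝ (Fin 3))) ∈ B ↔ (y = v ∨ y = b ∨ y = a₃ ∨ y = a₄)) ∧
    (∀ y, ({c, y} : Finset (EuclideanSpace ℝ (Fin 3))) ∈ B ↔ (y = v ∨ y = b ∨ y = c₃ ∨ y = c₄)) ∧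
    ({a₃, a₄} : Finset (EuclideanSpace ℝ (Fin 3))) ∈ B ∧
    ({c₃, c₄} : Finset (EuclideanSpace ℝ (Fin 3))) ∈ B ∧
    (∀ y, ({a₃, y} : Finset (EuclideanSpace ℝ (Fin 3))) ∈ B ↔ (y = d ∨ y = b₃ ∨ y = a ∨ y = a₄)) ∧
    (∀ y, ({c₃, y} : Finset (EuclideanSpace ℝ (Fin 3))) ∈ B ↔ (y = d ∨ y = b₃ ∨ y = c ∨ y = c₄)) ∧
    (∀ y, ({a₄, y} : Finset (EuclideanSpace ℝ (Fin 3))) ∈ B ↔ (y = e ∨ y = b₄ ∨ y = a ∨ y = a₃)) ∧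
    (∀ y, ({c₄, y} : Finset (EuclideanSpace ℝ (Fin 3))) ∈ B ↔ (y = e ∨ y = b₄ ∨ y = c ∨ y = c₃)) ∧
    (e ≠ a₃ ∧ e ≠ c₃ ∧ d ≠ a₄ ∧ d ≠ c₄ ∧ a₄ ≠ b₃ ∧ c₄ ≠ b₃ ∧ a₃ ≠ b₄ ∧ c₃ ≠ b₄) := by
  -- bonds read off the data
  have hvd : ({v, d} : Finset (EuclideanSpace ℝ (Fin 3))) ∈ B := (hN d).2 (Or.inr (Or.inr (Or.inr rfl)))
  have hbe : ({b, e} : Finset (EuclideanSpace ℝ (Fin 3))) ∈ B := (hNb e).2 (Or.inr (Or.inr (Or.inr rfl)))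
  have hdb₃ : ({d, b₃} : Finset (EuclideanSpace ℝ (Fin 3))) ∈ B := (hN₃ b₃).2 (Or.inr (Or.inl rfl))
  have heb₄ : ({e, b₄} : Finset (EuclideanSpace ℝ (Fin 3))) ∈ B := (hN₄ b₄).2 (Or.inr (Or.inl rfl))
  have hea₄ : ({e, a₄} : Finset (EuclideanSpace ℝ (Fin 3))) ∈ B := (hN₄ a₄).2 (Or.inl rfl)
  have hec₄ : ({e, c₄} : Finset (EuclideanSpace ℝ (Fin 3))) ∈ B := (hN₄ c₄).2 (Or.inr (Or.inr (Or.inl rfl)))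
  have hed : e ≠ d := he.2.2.2.2
  -- all the type data around
  obtain ⟨hN', hd', hcb, hba, hca, hcd', hbd', had'⟩ := typeA_swap hN hd hab hbc hac had hbd hcd
  obtain ⟨hN₃', hd₃', hcb₃, hba₃, hca₃, hcv₃', hbv₃', hav₃'⟩ :=
    typeA_swap hN₃ hd₃ hab₃ hbc₃ hac₃ hav₃ hbv₃ hcv₃
  obtain ⟨hN₄', hd₄', hcb₄', hba₄, hca₄, hcb₄'', hbb₄', hab₄''⟩ :=
    typeA_swap hN₄ hd₄ hab₄ hbc₄ hac₄ hab₄' hbb₄ hcb₄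
  obtain ⟨x, y, hNa, hdxy, -, hxy, -, -, -, -, houta⟩ :=
    typeA_wing hT hX1 hcard hsepX hB hBcard hdeg hN hd hab hbc hac had hbd
  obtain ⟨x', y', hNc, hdxy', -, hxy', -, -, -, -, houtc⟩ :=
    typeA_wing hT hX1 hcard hsepX hB hBcard hdeg hN' hd' hcb hba hca hcd' hbd'
  obtain ⟨p₃, q₃, hNa₃, hda₃, -, hpq₃, hn1, hn2, hn3, hn4, -⟩ :=
    typeA_wing hT hX1 hcard hsepX hB hBcard hdeg hN₃ hd₃ hab₃ hbc₃ hac₃ hav₃ hbv₃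
  obtain ⟨p₃', q₃', hNc₃, hdc₃, -, hpq₃', hm1, hm2, hm3, hm4, -⟩ :=
    typeA_wing hT hX1 hcard hsepX hB hBcard hdeg hN₃' hd₃' hcb₃ hba₃ hca₃ hcv₃' hbv₃'
  obtain ⟨p₄, q₄, hNa₄, hda₄, -, hpq₄, hk1, hk2, hk3, hk4, -⟩ :=
    typeA_wing hT hX1 hcard hsepX hB hBcard hdeg hN₄ hd₄ hab₄ hbc₄ hac₄ hab₄' hbb₄
  obtain ⟨p₄', q₄', hNc₄, hdc₄, -, hpq₄', hl1, hl2, hl3, hl4, -⟩ :=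
    typeA_wing hT hX1 hcard hsepX hB hBcard hdeg hN₄' hd₄' hcb₄' hba₄ hca₄ hcb₄'' hbb₄'
  obtain ⟨g₃, -, -, -, -, -, hNb₃, hdb₃', hB3a, hB3b, -, -, -, -⟩ :=
    typeA_partner hT hX1 hcard hsepX hB hBcard hdeg hN₃ hd₃ hab₃ hbc₃ hac₃ hbv₃
  obtain ⟨g₄, -, -, -, -, -, hNb₄, hdb₄', hB4a, hB4b, -, -, -, -⟩ :=
    typeA_partner hT hX1 hcard hsepX hB hBcard hdeg hN₄ hd₄ hab₄ hbc₄ hac₄ hbb₄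
  -- type exclusions
  have hea₃ : e ≠ a₃ := fun h => by
    subst h; exact typeO_typeA_false hNa₃ hda₃ hn1 hn2 hn3 hn4 hN₄ hd₄ hab₄ hbc₄
  have hec₃ : e ≠ c₃ := fun h => by
    subst h; exact typeO_typeA_false hNc₃ hdc₃ hm1 hm2 hm3 hm4 hN₄ hd₄ hab₄ hbc₄
  have hda₄' : d ≠ a₄ := fun h => by
    subst h; exact typeO_typeA_false hNa₄ hda₄ hk1 hk2 hk3 hk4 hN₃ hd₃ hab₃ hbc₃
  have hdc₄' : d ≠ c₄ := fun h => by
    subst h; exact typeO_typeA_false hNc₄ hdc₄ hl1 hl2 hl3 hl4 hN₃ hd₃ hab₃ hbc₃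
  have ha₄b₃ : a₄ ≠ b₃ := fun h => by
    subst h; exact typeO_typeA_false hNa₄ hda₄ hk1 hk2 hk3 hk4 hNb₃ hdb₃' hB3a hB3b
  have hc₄b₃ : c₄ ≠ b₃ := fun h => by
    subst h; exact typeO_typeA_false hNc₄ hdc₄ hl1 hl2 hl3 hl4 hNb₃ hdb₃' hB3a hB3b
  have ha₃b₄ : a₃ ≠ b₄ := fun h => by
    subst h; exact typeO_typeA_false hNa₃ hda₃ hn1 hn2 hn3 hn4 hNb₄ hdb₄' hB4a hB4b
  have hc₃b₄ : c₃ ≠ b₄ := fun h => by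
    subst h; exact typeO_typeA_false hNc₃ hdc₃ hm1 hm2 hm3 hm4 hNb₄ hdb₄' hB4a hB4b
  -- elementary inequalities
  have had'' : a ≠ d := hd.2.2.1
  have hcd'' : c ≠ d := hd.2.2.2.2.2
  have hab₃'' : a ≠ b₃ := fun h => had (by rw [h, Finset.pair_comm]; exact hdb₃)
  have hcb₃' : c ≠ b₃ := fun h => hcd (by rw [h, Finset.pair_comm]; exact hdb₃)
  have hab₄e : a ≠ b₄ := fun h => hae (by rw [h, Finset.pair_comm]; exact heb₄)
  have hcb₄e : c ≠ b₄ := fun h => hce (by rw [h, Finset.pair_comm]; exact heb₄)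
  have haa₃' : a ≠ a₃ := ne_of_mem_bonds hB haa₃
  have haa₄' : a ≠ a₄ := ne_of_mem_bonds hB haa₄
  have hcc₃' : c ≠ c₃ := ne_of_mem_bonds hB hcc₃
  have hcc₄' : c ≠ c₄ := ne_of_mem_bonds hB hcc₄
  have ha₃v : a₃ ≠ v := hd₃.2.2.1
  have hc₃v : c₃ ≠ v := hd₃.2.2.2.2.2
  have ha₃b : a₃ ≠ b := fun h => hbd (by rw [← h, Finset.pair_comm]; exact (hN₃ a₃).2 (Or.inl rfl))
  have hc₃b : c₃ ≠ b := fun h =>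
    hbd (by rw [← h, Finset.pair_comm]; exact (hN₃ c₃).2 (Or.inr (Or.inr (Or.inl rfl))))
  have ha₄v : a₄ ≠ v := fun h => hve (by rw [← h, Finset.pair_comm]; exact hea₄)
  have hc₄v : c₄ ≠ v := fun h => hve (by rw [← h, Finset.pair_comm]; exact hec₄)
  have ha₄b : a₄ ≠ b := hd₄.2.2.1
  have hc₄b : c₄ ≠ b := hd₄.2.2.2.2.2
  -- `a₃ ≠ a₄`, `c₃ ≠ c₄` (a common wing would be bonded to the non-bonded pair `a, e`)
  have ha₃e : ({a₃, e} : Finset (EuclideanSpace ℝ (Fin 3))) ∉ B := by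
    intro h
    rcases (hNa₃ e).1 h with h' | h' | h' | h'
    · exact hed h'
    · exact heb₃ h'
    · subst h'
      exact wing_not_common hNa₃ hpq₃ hae he.2.1.symm had'' hab₃'' hed heb₃
        (by rw [Finset.pair_comm]; exact haa₃) h
    · subst h'
      exact wing_not_common hNa₃ hpq₃ hae he.2.1.symm had'' hab₃'' hed heb₃
        (by rw [Finset.pair_comm]; exact haa₃) h
  have hc₃e : ({c₃, e} : Finset (EuclideanSpace ℝ (Fin 3))) ∉ B := by
    intro h
    rcases (hNc₃ e).1 h with h' | h' | h' | h'
    · exact hed h'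
    · exact heb₃ h'
    · subst h'
      exact wing_not_common hNc₃ hpq₃' hce he.2.2.2.1.symm hcd'' hcb₃' hed heb₃
        (by rw [Finset.pair_comm]; exact hcc₃) h
    · subst h'
      exact wing_not_common hNc₃ hpq₃' hce he.2.2.2.1.symm hcd'' hcb₃' hed heb₃
        (by rw [Finset.pair_comm]; exact hcc₃) h
  have ha₃₄ : a₃ ≠ a₄ := fun h => ha₃e (by rw [h, Finset.pair_comm]; exact hea₄)
  have hc₃₄ : c₃ ≠ c₄ := fun h => hc₃e (by rw [h, Finset.pair_comm]; exact hec₄)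
  -- the neighbourhoods of `a` and `c`
  obtain ⟨hNa', hBa⟩ := typeO_fill hNa hxy haa₃ haa₄ ha₃v ha₃b ha₄v ha₄b ha₃₄
  obtain ⟨hNc', hBc⟩ := typeO_fill hNc hxy' hcc₃ hcc₄ hc₃v hc₃b hc₄v hc₄b hc₃₄
  -- the neighbourhoods of the outer wings
  have ha₃a : ({a₃, a} : Finset (EuclideanSpace ℝ (Fin 3))) ∈ B := by
    rw [Finset.pair_comm]; exact haa₃
  have hc₃c : ({c₃, c} : Finset (EuclideanSpace ℝ (Fin 3))) ∈ B := by
    rw [Finset.pair_comm]; exact hcc₃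
  have ha₄a : ({a₄, a} : Finset (EuclideanSpace ℝ (Fin 3))) ∈ B := by
    rw [Finset.pair_comm]; exact haa₄
  have hc₄c : ({c₄, c} : Finset (EuclideanSpace ℝ (Fin 3))) ∈ B := by
    rw [Finset.pair_comm]; exact hcc₄
  have ha₄a₃ : ({a₄, a₃} : Finset (EuclideanSpace ℝ (Fin 3))) ∈ B := by
    rw [Finset.pair_comm]; exact hBa
  have hc₄c₃ : ({c₄, c₃} : Finset (EuclideanSpace ℝ (Fin 3))) ∈ B := by
    rw [Finset.pair_comm]; exact hBc
  obtain ⟨hNa₃', -⟩ := typeO_fill hNa₃ hpq₃ ha₃a hBa had'' hab₃'' hda₄'.symm ha₄b₃ haa₄'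
  obtain ⟨hNc₃', -⟩ := typeO_fill hNc₃ hpq₃' hc₃c hBc hcd'' hcb₃' hdc₄'.symm hc₄b₃ hcc₄'
  obtain ⟨hNa₄', -⟩ := typeO_fill hNa₄ hpq₄ ha₄a ha₄a₃ he.2.1.symm hab₄e hea₃.symm ha₃b₄ haa₃'
  obtain ⟨hNc₄', -⟩ := typeO_fill hNc₄ hpq₄' hc₄c hc₄c₃ he.2.2.2.1.symm hcb₄e hec₃.symm hc₃b₄ hcc₃'
  exact ⟨ha₃₄, hc₃₄, hNa', hNc', hBa, hBc, hNa₃', hNc₃', hNa₄', hNc₄',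
    ⟨hea₃, hec₃, hda₄', hdc₄', ha₄b₃, hc₄b₃, ha₃b₄, hc₃b₄⟩⟩

end Setting

end Summit.AtomisticToContinuum.Crystallization.Theorems
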